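import Summits.Ventures.CertifiedManyBodySolver.Certificates.EmeryCu4O8_kryFam_Hg1201P0_c1hl
import Summits.Ventures.CertifiedManyBodySolver.Downfold.EmeryBoxesCCOCK26FloorWord
import Summits.Ventures.CertifiedManyBodySolver.Downfold.EmeryBoxesCCOCK26ThermalFloorAtlasWord
import Summits.Ventures.CertifiedManyBodySolver.Downfold.EmeryBoxesKSlicesC
import Summits.Ventures.CertifiedManyBodySolver.Downfold.EmeryThermalAtomicFloor
import Summits.Ventures.CertifiedManyBodySolver.Downfold.EmeryThermalCapFromFloorSeam
import HarnessLib

/-!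
# `T > 0` WORDS ON A PRESSURE-CONTINUUM OBJECT (zero kit): cap, ATLAS floor, two-sided window and the HIGH-T-CLOSING window on
# Ca2CuO2Cl2 (M58 parent, x = 0 column) U-slice — same six-box as CCOCK26 (filling differs; T > 0 words are filling-free) — `emeryBoxCCOCx0K26` (router/EMERY-FLOOR-ORDERS rows 47·…; first certified thermal statements on a P-hull box)

Venture CertifiedManyBodySolver, cell `pub/hubbard-downfold` (S1 = ROUTER) × crew hubbard-fast S2 (ii) × (iv) «T > 0 × multi-band» (D-0096 (ii)); seat hubbard-downfold-mod-4
(S1/S2 Emery seam, g17). Namespace `Summit.Ventures.CertifiedManyBodySolver.Downfold`. THE OBJECT: the coordinatewise hull of the two computed-pressure U-slices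
(this seat's `EmeryBoxesKSlicesC`; a word on it holds at both computed pressures by the `_refines_PHull` lemmas and at every admitted intermediate P). INPUTS BY NAME (all landed,
nothing recomputed): the four lower-face CuO₄ certificates `cCOCK26Floor_hq 0`, `cCOCK26Floor_hq 1`, `cCOCK26Floor_hq 2`, `cCOCK26Floor_hq 3` (hubbard-box-p2 g17 HULL-ATLAS `EmeryHullAtlasNewVertices*` / g16 vertex floors; tilts μ = (-10, -53/5, -103/10, -109/10),
q₀ = (-6421459/80000, -3498641/40000, -6694287/80000, -908777/10000)); hubbard-box-p1's cap law (R153) via this seat's `holdsOn_emeryCellPressureCap_of_tiltedCuO4Certificates`; the `T > 0` FLOOR ATLAS (best of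
hubbard-box-p2's 33 global KLDL-R families at εp = -10: `kryFam_Hg1201P0_c1hl`, C = (-146.878157, -148.577713)); the atomic-limit door `EmeryThermalAtomicFloor` (p681554).
RESULT (every β ≥ 0, hypothesis-free): cap `P_cell ≤ 6 log 2 + 45.4389·β`; window **`37.1444·β ≤ P_cell ≤ 45.4389·β + 6 log 2`** (slope gap 8.2944);
high-T closure `P_cell(0) = 6 log 2`; hubbard-box-p2's T = 0 chord band `emeryBoxCCOCx0K26_cuprate_energyChordBandAtFilling` is the T = 0 companion.

Everything PROVED (0 sorry); no definition. HONEST FRAMING: CERTIFIED inequalities on an EXTRAPOLATED-grade interpolation object (hull of two SCREENING-grade computed-pressure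
slices); grand-canonical at the stated level; thermal scales NOT resolved; no phase word; no router number moves. WHAT-THIS-IS-NOT: new certificates or kit.
-/

noncomputable section

namespace Summit.Ventures.CertifiedManyBodySolver.Downfold

open NonemptyInterval Matrix Finset Literature.Probability.LatticeModels
open Literature.MathematicalPhysics.QuantumLattice Literature.Computation.Certificates
open Summit.Ventures.CertifiedManyBodySolver.Certificates OccupationCode ClusterLowerBound
open scoped BigOperators ComplexOrder

/-! ## §1 The lower-face corners and their CuO₄ certificates (hubbard-box-p2 g17 HULL-ATLAS `atlasNew_*_hq` / g16 `<vpre>_*_hq`) -/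


/-! ## §2 The `T > 0` cap word at the common level εp = -10 (= max μᵢ; tilts μ = (-10, -53/5, -103/10, -109/10), levels q₀ = (-6421459/80000, -3498641/40000, -6694287/80000, -908777/10000), slopes −q₀/2 = (40.1341, 43.7330, 41.8393, 45.4389)) -/

/-- **THE THERMAL CAP WORD (hypothesis-free)** on `emeryBoxCCOCx0K26`, cuprate signs, level `εp = -10`, EVERY β ≥ 0, EVERY point of the box:
`P_cell ≤ 6 log 2 + β·908777/20000` (45.4389·β + 4.1589; corner 3 binds) — the four lower-face CuO₄ certificates of hubbard-box-p2's HULL-ATLAS (kit-free for three of four objects' corners; registry code/atlas/state/plan.json) through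
hubbard-box-p1's R153 and monotone level transfer. [cite: Israel1979, Thm. I.2.4] [cite: ValentiStolzeHirschfeld1991, §II] -/
theorem emeryBoxCCOCx0K26_pressureCap_m10 {β : ℝ} (hβ : 0 ≤ β) :
    HoldsOn (fun p : EmeryCoord → ℝ => emeryCellPressure β (emeryLine cuprateSigns (emeryLineCoords (((-10 : ℚ)) : ℝ) p)) ≤ 6 * Real.log 2 + β * (908777/20000 : ℝ)) emeryBoxCCOCx0K26 :=
  holdsOn_emeryCellPressureCap_of_tiltedCuO4Certificates (E := emeryBoxCCOCx0K26) (eA := ccocK26Emery_tpd) (eB := ccocK26Emery_tpp) (eD := ccocK26Emery_Delta) (eUd := ccocK26Emery_Udd) (eUp := ccocK26Emery_Upp) emeryBoxCCOCx0K26_entries.1 emeryBoxCCOCx0K26_entries.2.1 emeryBoxCCOCx0K26_entries.2.2.1 emeryBoxCCOCx0K26_entries.2.2.2.1 emeryBoxCCOCx0K26_entries.2.2.2.2 cuprateSigns hβ (M := 2) two_pos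
    (fun _ => 0) (fun _ ω' _ => re_expect_zero_cuO4 ω') (![-10, -53/5, -103/10, -109/10] : Fin 4 → ℝ) (![-6421459/80000, -3498641/40000, -6694287/80000, -908777/10000] : Fin 4 → ℝ)
    (fun i => by
      rw [cCOCK26_lowerCorner]
      fin_cases i
      · simpa [cCOCK26Corner, cCOCK26Floor_mu, cCOCK26Floor_q0] using cCOCK26Floor_hq 0
      · simpa [cCOCK26Corner, cCOCK26Floor_mu, cCOCK26Floor_q0] using cCOCK26Floor_hq 1
      · simpa [cCOCK26Corner, cCOCK26Floor_mu, cCOCK26Floor_q0] using cCOCK26Floor_hq 2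
      · simpa [cCOCK26Corner, cCOCK26Floor_mu, cCOCK26Floor_q0] using cCOCK26Floor_hq 3)
    (fun i => by fin_cases i <;> simp <;> norm_num) (fun i => by fin_cases i <;> simp <;> norm_num)

/-- **Grand-potential reading**: at chemical potential 10 eV, every `T > 0`, every point: `Ω/CuO₂ = −P_cell/β ≥ −908777/20000 − 6 log 2/β` eV. [cite: Israel1979, Thm. I.2.4] -/
theorem emeryBoxCCOCx0K26_grandPotential_ge_m10 {β : ℝ} (hβ : 0 < β) :
    HoldsOn (fun p : EmeryCoord → ℝ => -(908777/20000 : ℝ) - 6 * Real.log 2 / β ≤ -emeryCellPressure β (emeryLine cuprateSigns (emeryLineCoords (((-10 : ℚ)) : ℝ) p)) / β) emeryBoxCCOCx0K26 :=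
  holdsOn_grandPotential_ge_of_pressureCap cuprateSigns hβ _ (emeryBoxCCOCx0K26_pressureCap_m10 hβ.le)

/-! ## §3 The ATLAS family floor (best of 33 global KLDL-R families at εp = -10: `kryFam_Hg1201P0_c1hl`, N = 19, 20) and the two-sided window — the closed-form member bounds are the reference object’s landed lemmas `cCOCK26Atlas_Hg1201P0_c1hl_m10_cap<j>` (EmeryBoxesCCOCK26ThermalFloorAtlasWord), imported, not restated -/

/-- **`T > 0` ATLAS FAMILY FLOOR** on the whole box, every β ≥ 0: `¼·log Σⱼ e^{−βCⱼ} ≤ P_cell`, C = (-146878157/1000000, -148577713/1000000). [cite: Ruelle1969, §2.5–2.6] [cite: Israel1979, Lemma II.3.1] -/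
theorem emeryBoxCCOCx0K26_pressureFloorFam_m10 {β : ℝ} (hβ : 0 ≤ β) :
    HoldsOn (fun p : EmeryCoord → ℝ => Real.log (Real.exp (-(β * (-146878157/1000000 : ℝ))) + Real.exp (-(β * (-148577713/1000000 : ℝ)))) / 4 ≤ emeryCellPressure β (emeryLine cuprateSigns (emeryLineCoords (((-10 : ℚ)) : ℝ) p))) emeryBoxCCOCx0K26 := by
  have h := holdsOn_emeryCellPressureFloor_of_rayleighTraces (E := emeryBoxCCOCx0K26) (εp := -10) (eA := ccocK26Emery_tpd) (eB := ccocK26Emery_tpp) (eD := ccocK26Emery_Delta)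
    (eUd := ccocK26Emery_Udd) (eUp := ccocK26Emery_Upp) emeryBoxCCOCx0K26_entries.1 emeryBoxCCOCx0K26_entries.2.1 emeryBoxCCOCx0K26_entries.2.2.1 emeryBoxCCOCx0K26_entries.2.2.2.1 emeryBoxCCOCx0K26_entries.2.2.2.2 cuprateSigns hβ
    (φ := fun i => ((kryFam_Hg1201P0_c1hl i).unit : Fock (Orb (Fin 1 ×ₗ Fin 12)))) kryFam_Hg1201P0_c1hl_orthonormal
    (T := fun i a => ((kryFam_Hg1201P0_c1hl_S i a : ℤ) : ℝ) / ((kryFam_Hg1201P0_c1hl_NN i : ℤ) : ℝ)) kryFam_Hg1201P0_c1hl_traces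
  intro p hp
  have h' := h p hp
  simp only [Fin.sum_univ_two] at h'
  refine le_trans ?_ h'
  exact div_le_div_of_nonneg_right (Real.log_le_log (by positivity) (add_le_add (Real.exp_le_exp.2 (neg_le_neg (mul_le_mul_of_nonneg_left cCOCK26Atlas_Hg1201P0_c1hl_m10_cap0 hβ))) (Real.exp_le_exp.2 (neg_le_neg (mul_le_mul_of_nonneg_left cCOCK26Atlas_Hg1201P0_c1hl_m10_cap1 hβ))))) (by norm_num)

/-- **Linear reading of the floor**: `β·148577713/4000000 ≤ P_cell` (37.1444·β). [cite: Ruelle1969, §2.5–2.6] -/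
theorem emeryBoxCCOCx0K26_pressureFloorLinear_m10 {β : ℝ} (hβ : 0 ≤ β) :
    HoldsOn (fun p : EmeryCoord → ℝ => β * (148577713/4000000 : ℝ) ≤ emeryCellPressure β (emeryLine cuprateSigns (emeryLineCoords (((-10 : ℚ)) : ℝ) p))) emeryBoxCCOCx0K26 := by
  intro p hp
  refine le_trans ?_ (emeryBoxCCOCx0K26_pressureFloorFam_m10 hβ p hp)
  have hk : β * (148577713/4000000 : ℝ) = Real.log (Real.exp (-(β * (-148577713/1000000 : ℝ)))) / 4 := by
    rw [Real.log_exp]; ring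
  rw [hk]
  refine div_le_div_of_nonneg_right (Real.log_le_log (by positivity) ?_) (by norm_num)
  nlinarith [Real.exp_pos (-(β * (-146878157/1000000 : ℝ)))]

/-- **TWO-SIDED `T > 0` WINDOW ON THE PRESSURE-HULL BOX** (hypothesis-free on both sides), level εp = -10, EVERY β ≥ 0:
`¼·log Σⱼ e^{−βCⱼ} ≤ P_cell ≤ 6 log 2 + β·908777/20000` (linear reading `37.1444·β ≤ P_cell ≤ 45.4389·β + 4.1589`; slope gap 8.2944). It holds at BOTH computed pressures and at every
admitted intermediate P (the box's premise). [cite: Israel1979, Thm. I.2.4] [cite: Ruelle1969, §2.5–2.6] -/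
theorem emeryBoxCCOCx0K26_pressureWindow_m10 {β : ℝ} (hβ : 0 ≤ β) :
    HoldsOn (fun p : EmeryCoord → ℝ => Real.log (Real.exp (-(β * (-146878157/1000000 : ℝ))) + Real.exp (-(β * (-148577713/1000000 : ℝ)))) / 4 ≤ emeryCellPressure β (emeryLine cuprateSigns (emeryLineCoords (((-10 : ℚ)) : ℝ) p)) ∧ emeryCellPressure β (emeryLine cuprateSigns (emeryLineCoords (((-10 : ℚ)) : ℝ) p)) ≤ 6 * Real.log 2 + β * (908777/20000 : ℝ)) emeryBoxCCOCx0K26 :=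
  fun p hp => ⟨emeryBoxCCOCx0K26_pressureFloorFam_m10 hβ p hp, emeryBoxCCOCx0K26_pressureCap_m10 hβ p hp⟩

/-- **Linear reading of the window**: `β·148577713/4000000 ≤ P_cell ≤ 6 log 2 + β·908777/20000`. [cite: Israel1979, Thm. I.2.4] -/
theorem emeryBoxCCOCx0K26_pressureWindow_m10_linear {β : ℝ} (hβ : 0 ≤ β) :
    HoldsOn (fun p : EmeryCoord → ℝ => β * (148577713/4000000 : ℝ) ≤ emeryCellPressure β (emeryLine cuprateSigns (emeryLineCoords (((-10 : ℚ)) : ℝ) p)) ∧ emeryCellPressure β (emeryLine cuprateSigns (emeryLineCoords (((-10 : ℚ)) : ℝ) p)) ≤ 6 * Real.log 2 + β * (908777/20000 : ℝ)) emeryBoxCCOCx0K26 :=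
  fun p hp => ⟨emeryBoxCCOCx0K26_pressureFloorLinear_m10 hβ p hp, emeryBoxCCOCx0K26_pressureCap_m10 hβ p hp⟩

/-! ## §4 The atomic-limit floor and the HIGH-TEMPERATURE-CLOSING window -/

/-- **ATOMIC-LIMIT `T > 0` FLOOR** on the whole box at εp = -10, every β ≥ 0 (door `holdsOn_emeryCellPressureAtomicFloor`; Cu at μ_d = 331/50, U_d,hi = 154/25; O at μ_p = 10,
U_p,hi = 2619/500); value `6 log 2` at β = 0, classical slope 36.6040·β as β → ∞. [cite: Ruelle1969, §2.5–2.6] [cite: Ueltschi1999, §3] -/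
theorem emeryBoxCCOCx0K26_pressureAtomicFloor_m10 {β : ℝ} (hβ : 0 ≤ β) :
    HoldsOn (fun p : EmeryCoord → ℝ => Real.log (atomicPartitionFnReal β (154/25 : ℝ) (331/50 : ℝ)) + 2 * Real.log (atomicPartitionFnReal β (2619/500 : ℝ) (10 : ℝ)) ≤ emeryCellPressure β (emeryLine cuprateSigns (emeryLineCoords (((-10 : ℚ)) : ℝ) p))) emeryBoxCCOCx0K26 := by
  intro p hp
  have h := holdsOn_emeryCellPressureAtomicFloor (E := emeryBoxCCOCx0K26) (eA := ccocK26Emery_tpd) (eB := ccocK26Emery_tpp) (eD := ccocK26Emery_Delta) (eUd := ccocK26Emery_Udd) (eUp := ccocK26Emery_Upp) (-10) emeryBoxCCOCx0K26_entries.1 emeryBoxCCOCx0K26_entries.2.1 emeryBoxCCOCx0K26_entries.2.2.1 emeryBoxCCOCx0K26_entries.2.2.2.1 emeryBoxCCOCx0K26_entries.2.2.2.2 cuprateSigns hβ p hp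
  simp only [ccocK26Emery_Delta, ccocK26Emery_Udd, ccocK26Emery_Upp, Entry.encl_ofEnds_snd] at h
  push_cast at h
  norm_num at h ⊢
  exact h

/-- **THE HIGH-TEMPERATURE-CLOSING TWO-SIDED `T > 0` WINDOW** on the whole box, εp = -10, every β ≥ 0: `max(atomic, family) ≤ P_cell ≤ 6 log 2 + β·908777/20000`; both sides
equal `6 log 2` at β = 0; crossover β* ≈ 1.328 (T* ≈ 8740 K) [float]. Table [float]:
| β (1/eV) | T (K) | atomic floor | family floor | best floor | cap | width |
|---|---|---|---|---|---|---|
| 0.01 | 1160450 | 4.3868 | 0.5426 | 4.3868 | 4.6133 | 0.2265 |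
| 0.1 | 116045 | 6.6940 | 3.8674 | 6.6940 | 8.7028 | 2.0087 |
| 0.5 | 23209 | 19.6048 | 18.6612 | 19.6048 | 26.8783 | 7.2735 |
| 1 | 11604 | 37.4548 | 37.1864 | 37.4548 | 49.5977 | 12.1430 |
| 2 | 5802 | 73.7944 | 74.2971 | 74.2971 | 95.0366 | 20.7395 |
| 5 | 2321 | 183.2028 | 185.7222 | 185.7222 | 231.3531 | 45.6309 |
| 10 | 1160 | 366.0599 | 371.4443 | 371.4443 | 458.5474 | 87.1031 |
| 20 | 580 | 732.0802 | 742.8886 | 742.8886 | 912.9359 | 170.0473 |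
| 40 | 290 | 1464.1600 | 1485.7771 | 1485.7771 | 1821.7129 | 335.9358 |
[cite: Israel1979, Thm. I.2.4] [cite: Ruelle1969, §2.5–2.6] [cite: Ueltschi1999, §3] -/
theorem emeryBoxCCOCx0K26_pressureWindowHighT_m10 {β : ℝ} (hβ : 0 ≤ β) :
    HoldsOn (fun p : EmeryCoord → ℝ =>
      max (Real.log (atomicPartitionFnReal β (154/25 : ℝ) (331/50 : ℝ)) + 2 * Real.log (atomicPartitionFnReal β (2619/500 : ℝ) (10 : ℝ))) (Real.log (Real.exp (-(β * (-146878157/1000000 : ℝ))) + Real.exp (-(β * (-148577713/1000000 : ℝ)))) / 4) ≤ emeryCellPressure β (emeryLine cuprateSigns (emeryLineCoords (((-10 : ℚ)) : ℝ) p)) ∧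
      emeryCellPressure β (emeryLine cuprateSigns (emeryLineCoords (((-10 : ℚ)) : ℝ) p)) ≤ 6 * Real.log 2 + β * (908777/20000 : ℝ)) emeryBoxCCOCx0K26 :=
  fun p hp => ⟨max_le (emeryBoxCCOCx0K26_pressureAtomicFloor_m10 hβ p hp) (emeryBoxCCOCx0K26_pressureFloorFam_m10 hβ p hp), emeryBoxCCOCx0K26_pressureCap_m10 hβ p hp⟩

/-- **At β = 0 the window is a point**: `P_cell(0, ·) = 6 log 2` on the whole box. [cite: Ueltschi1999, §3] -/
theorem emeryBoxCCOCx0K26_pressure_beta_zero_m10 :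
    HoldsOn (fun p : EmeryCoord → ℝ => emeryCellPressure 0 (emeryLine cuprateSigns (emeryLineCoords (((-10 : ℚ)) : ℝ) p)) = 6 * Real.log 2) emeryBoxCCOCx0K26 := by
  intro p hp
  have h := emeryBoxCCOCx0K26_pressureWindowHighT_m10 le_rfl p hp
  rw [atomicPartitionFnReal_beta_zero, atomicPartitionFnReal_beta_zero, show (4 : ℝ) = 2 ^ 2 by norm_num, Real.log_pow] at h
  simp only [Nat.cast_ofNat, zero_mul, add_zero] at h
  have h1 := (le_max_left _ _).trans h.1
  linarith [h.2]

end Summit.Ventures.CertifiedManyBodySolver.Downfold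

end
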